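import Mathlib
import Summits.NavierStokesRegularity.NavierStokesRegularity.Theorems.FilamentSkeletonRssMatchedKernelDifferentiable
import Summits.NavierStokesRegularity.NavierStokesRegularity.Theorems.FilamentSkeletonRssMatchedKernelDirectionalDeriv

/-!
# The MATCHED-CORE Biot–Savart field: the VARIATION DERIVATIVE along a displacement of the filament
# `d/ds|₀ ∫ K_m(y − (X u + sY u)) • (X′u + sY′u) × (y − (X u + sY u)) du` (differentiation under the integral sign)

Route `FilamentSkeletonRss`, A1G cone, toward child **28296 `Clause13NearStraight`** of `SkeletonJ1G` (stmt-27849): clause 13-J is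
the weighted injectivity of the LINEARISED normal-velocity map `Y ↦ d/ds T(X+sY)|₀`, whose first ingredient is the variation
derivative of the skeleton's own velocity field `u Z y = Σ_k (Γγ_k/4π) ∫ K(y, Z k σ, Aa k σ) • Z_k′σ × (y − Z k σ) dσ` along
`Z = X + sY` at a FIXED point `y` (the other two ingredients — the motion of the evaluation point, `∇u_X(X j τ)·Y j τ`,
and the tangential projection — are `MatchedKernel.matchedBiotSavart_hasFDerivAt` (p643796) and algebra).  This file proves
it for ONE filament with a matched core PROFILE `m ≥ m₀ > 0` (continuous): for a `C¹` proper filament `X` (`‖X′‖ ≤ 1`,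
`c|u| − C ≤ ‖X u‖`) and a `C¹` displacement `Y` with `‖Y‖, ‖Y′‖ ≤ B`,

  `s ↦ ∫ ((‖y − (X u + s•Y u)‖² + m u)^{3/2})⁻¹ • (X′u + s•Y′u) × (y − (X u + s•Y u)) du`

has at `s = 0` the derivative `∫ [3⟨y − X u, Y u⟩((‖y−X u‖²+m u)^{5/2})⁻¹ • X′u × (y − X u)
 + ((‖y−X u‖²+m u)^{3/2})⁻¹ • (Y′u × (y − X u) − X′u × Y u)] du` (`matchedBiotSavart_hasDerivAt_variation`), the
derivative integrand being integrable.  Pointwise calculus (§1) along `w(s) = y + s•v − b` with the cross factor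
`(a + s•a′) × w(s)` (bilinear product rule, `crossCLM`), the bound `‖∂_s‖ ≤ (B + 4B(1+B)(√q)⁻¹)(‖w‖²+q)⁻¹` for `|s| ≤ 1`
(§2), the uniform domination `(‖w‖²+m u)⁻¹ ≤ M(1+u²)⁻¹` of `…DirectionalDeriv.inv_le_of_norm_sub_le` with `R = B`, and
Mathlib's `hasDerivAt_integral_of_dominated_loc_of_deriv_le` (§3).  Lane ns-filament-19175-p1 g12 (hand of record for
28296 per tenure dss_102); `--supports stmt-NavierStokesRegularity-28296 --as helper`.
HONEST FRAMING: calculus for a HYPOTHETICAL filament skeleton on the NEGATIVE side of a MODEL route; nothing here bears on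
Navier–Stokes regularity or blow-up.
-/

noncomputable section

open MeasureTheory Filter Topology Metric
open Literature.Analysis.FluidPDE

namespace Summit.NavierStokesRegularity.NavierStokesRegularity.Theorems.MatchedKernel
set_option linter.dupNamespace false

/-! ### §1  Pointwise calculus along `w(s) = y + s•v − b` with the cross factor `(a + s•a′) × w(s)` -/

/-- `s ↦ (a + s•a′) × (y + s•v − b)` has derivative `(a + s•a′) × v + a′ × (y + s•v − b)` (bilinear product rule). [folklore] -/
theorem hasDerivAt_cross_affine (a a' y v b : EuclideanSpace ℝ (Fin 3)) (s : ℝ) :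
    HasDerivAt (fun s : ℝ => cross (a + s • a') (y + s • v - b))
      (cross (a + s • a') v + cross a' (y + s • v - b)) s := by
  have hu : HasDerivAt (fun s : ℝ => a + s • a') a' s := by
    have := ((hasDerivAt_id' (x := s)).smul_const a').const_add a
    simpa using this
  exact crossCLM.hasDerivAt_of_bilinear (fun _ => hu) (fun _ => hasDerivAt_line_sub y v b s)

/-- The `s`-derivative of the VARIATION integrand `K₃(w(s)) • (a + s•a′) × w(s)`, `w(s) = y + s•v − b` (`q > 0`). [folklore] -/
theorem variationIntegrand_hasDerivAt {q : ℝ} (hq : 0 < q) (a a' y v b : EuclideanSpace ℝ (Fin 3)) (s : ℝ) :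
    HasDerivAt (fun s : ℝ => ((‖y + s • v - b‖ ^ 2 + q) ^ (3 / 2 : ℝ))⁻¹ • cross (a + s • a') (y + s • v - b))
      ((-3 * inner ℝ (y + s • v - b) v * ((‖y + s • v - b‖ ^ 2 + q) ^ (5 / 2 : ℝ))⁻¹) •
          cross (a + s • a') (y + s • v - b) +
        ((‖y + s • v - b‖ ^ 2 + q) ^ (3 / 2 : ℝ))⁻¹ • (cross (a + s • a') v + cross a' (y + s • v - b))) s :=
  ((kernel_hasDerivAt_line hq y v b s).smul (hasDerivAt_cross_affine a a' y v b s)).congr_deriv (add_comm _ _)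

/-! ### §2  The pointwise bound on the `s`-derivative -/

/-- `‖∂_s [K₃(w) • (a + s•a′) × w]‖ ≤ (B + 4B(1+B)(√q)⁻¹)·(‖w‖² + q)⁻¹` for `‖a‖ ≤ 1`, `‖a′‖, ‖v‖ ≤ B`, `|s| ≤ 1`. [folklore] -/
theorem norm_variationDeriv_le {q : ℝ} (hq : 0 < q) {B s : ℝ} (hB : 0 ≤ B) (hs : |s| ≤ 1)
    (a a' w v : EuclideanSpace ℝ (Fin 3)) (ha : ‖a‖ ≤ 1) (ha' : ‖a'‖ ≤ B) (hv : ‖v‖ ≤ B) :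
    ‖(-3 * inner ℝ w v * ((‖w‖ ^ 2 + q) ^ (5 / 2 : ℝ))⁻¹) • cross (a + s • a') w +
        ((‖w‖ ^ 2 + q) ^ (3 / 2 : ℝ))⁻¹ • (cross (a + s • a') v + cross a' w)‖
      ≤ (B + 4 * B * (1 + B) * (Real.sqrt q)⁻¹) * (‖w‖ ^ 2 + q)⁻¹ := by
  set σ := ‖w‖ ^ 2 + q with hσ_def
  have hσ0 : 0 < σ := by positivity
  have hqσ : q ≤ σ := le_add_of_nonneg_left (sq_nonneg _)
  have hwσ : ‖w‖ ^ 2 ≤ σ := le_add_of_nonneg_right hq.le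
  have hk3 : (σ ^ (3 / 2 : ℝ))⁻¹ = σ ^ (-(3 / 2) : ℝ) := (Real.rpow_neg hσ0.le _).symm
  have hk5 : (σ ^ (5 / 2 : ℝ))⁻¹ = σ ^ (-(5 / 2) : ℝ) := (Real.rpow_neg hσ0.le _).symm
  -- the moving tangent `p = a + s a′` has norm ≤ 1 + B
  have hp : ‖a + s • a'‖ ≤ 1 + B := by
    calc ‖a + s • a'‖ ≤ ‖a‖ + ‖s • a'‖ := norm_add_le _ _
      _ ≤ 1 + |s| * B := by rw [norm_smul, Real.norm_eq_abs]; gcongr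
      _ ≤ 1 + 1 * B := by gcongr
      _ = 1 + B := by ring
  have hpw : ‖cross (a + s • a') w‖ ≤ (1 + B) * ‖w‖ :=
    (norm_cross_le_norm_mul_norm _ _).trans (mul_le_mul_of_nonneg_right hp (norm_nonneg _))
  have hpv : ‖cross (a + s • a') v‖ ≤ (1 + B) * B :=
    (norm_cross_le_norm_mul_norm _ _).trans (mul_le_mul hp hv (norm_nonneg _) (by positivity))
  have haw : ‖cross a' w‖ ≤ B * ‖w‖ :=
    (norm_cross_le_norm_mul_norm _ _).trans (mul_le_mul_of_nonneg_right ha' (norm_nonneg _))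
  have hi : |inner ℝ w v| ≤ ‖w‖ * ‖v‖ := abs_real_inner_le_norm w v
  -- `σ^{-3/2} ≤ (√q)⁻¹ σ⁻¹` and `‖w‖ σ^{-3/2} ≤ σ⁻¹`
  have h32 := rpow_neg_three_halves_le hq hqσ
  have hw1 : ‖w‖ * σ ^ (-(3 / 2) : ℝ) ≤ σ⁻¹ := by
    have hws : ‖w‖ ≤ Real.sqrt σ := Real.le_sqrt_of_sq_le hwσ
    rw [show (-(3 / 2) : ℝ) = -(1 / 2) + -1 by norm_num, Real.rpow_add hσ0, Real.rpow_neg_one,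
      Real.rpow_neg hσ0.le, ← Real.sqrt_eq_rpow, ← mul_assoc]
    have hsq : 0 < Real.sqrt σ := Real.sqrt_pos.mpr hσ0
    calc ‖w‖ * (Real.sqrt σ)⁻¹ * σ⁻¹ ≤ Real.sqrt σ * (Real.sqrt σ)⁻¹ * σ⁻¹ := by gcongr
      _ = σ⁻¹ := by rw [mul_inv_cancel₀ hsq.ne', one_mul]
  -- term 1
  have h1 : ‖(-3 * inner ℝ w v * (σ ^ (5 / 2 : ℝ))⁻¹) • cross (a + s • a') w‖
      ≤ 3 * B * (1 + B) * σ ^ (-(3 / 2) : ℝ) := by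
    rw [norm_smul, hk5, Real.norm_eq_abs, abs_mul, abs_mul, abs_neg, abs_of_pos (by norm_num : (0 : ℝ) < 3),
      abs_of_nonneg (Real.rpow_nonneg hσ0.le _)]
    calc 3 * |inner ℝ w v| * σ ^ (-(5 / 2) : ℝ) * ‖cross (a + s • a') w‖
        ≤ 3 * (‖w‖ * B) * σ ^ (-(5 / 2) : ℝ) * ((1 + B) * ‖w‖) := by
          refine mul_le_mul (by gcongr; exact hi.trans (by gcongr)) hpw (norm_nonneg _) (by positivity)
      _ = 3 * B * (1 + B) * (σ ^ (-(5 / 2) : ℝ) * ‖w‖ ^ 2) := by ring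
      _ ≤ 3 * B * (1 + B) * (σ ^ (-(5 / 2) : ℝ) * σ) := by gcongr
      _ = 3 * B * (1 + B) * σ ^ (-(3 / 2) : ℝ) := by
          rw [show (-(3 / 2) : ℝ) = -(5 / 2) + 1 by norm_num, Real.rpow_add_one hσ0.ne']
  -- term 2
  have h2 : ‖(σ ^ (3 / 2 : ℝ))⁻¹ • (cross (a + s • a') v + cross a' w)‖
      ≤ (1 + B) * B * σ ^ (-(3 / 2) : ℝ) + B * σ⁻¹ := by
    rw [norm_smul, hk3, Real.norm_of_nonneg (Real.rpow_nonneg hσ0.le _)]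
    calc σ ^ (-(3 / 2) : ℝ) * ‖cross (a + s • a') v + cross a' w‖
        ≤ σ ^ (-(3 / 2) : ℝ) * ((1 + B) * B + B * ‖w‖) := by
          refine mul_le_mul_of_nonneg_left ((norm_add_le _ _).trans (add_le_add hpv haw)) (Real.rpow_nonneg hσ0.le _)
      _ = (1 + B) * B * σ ^ (-(3 / 2) : ℝ) + B * (‖w‖ * σ ^ (-(3 / 2) : ℝ)) := by ring
      _ ≤ (1 + B) * B * σ ^ (-(3 / 2) : ℝ) + B * σ⁻¹ := by gcongr
  calc _ ≤ _ := norm_add_le _ _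
    _ ≤ 3 * B * (1 + B) * σ ^ (-(3 / 2) : ℝ) + ((1 + B) * B * σ ^ (-(3 / 2) : ℝ) + B * σ⁻¹) := add_le_add h1 h2
    _ = 4 * B * (1 + B) * σ ^ (-(3 / 2) : ℝ) + B * σ⁻¹ := by ring
    _ ≤ 4 * B * (1 + B) * ((Real.sqrt q)⁻¹ * σ⁻¹) + B * σ⁻¹ := by gcongr
    _ = (B + 4 * B * (1 + B) * (Real.sqrt q)⁻¹) * σ⁻¹ := by ring


/-- `a × (−b) = −(a × b)`. [folklore] -/
theorem cross_neg_right (a b : EuclideanSpace ℝ (Fin 3)) : cross a (-b) = -cross a b := by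
  rw [← crossCLM_apply, map_neg, crossCLM_apply]

/-! ### §3  Differentiation under the integral sign: the variation derivative at `s = 0` -/

/-- Continuity in `u` of the variation integrand at parameter `s` (`X, Y` of class `C¹`, `m` continuous with a floor). [folklore] -/
theorem continuous_variationIntegrand {m : ℝ → ℝ} {m₀ : ℝ} (hm₀ : 0 < m₀) (hm : ∀ u, m₀ ≤ m u) (hmc : Continuous m)
    {X Y : ℝ → EuclideanSpace ℝ (Fin 3)} (hX : ContDiff ℝ 1 X) (hY : ContDiff ℝ 1 Y) (y : EuclideanSpace ℝ (Fin 3)) (s : ℝ) :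
    Continuous (fun u : ℝ => ((‖y + s • (-Y u) - X u‖ ^ 2 + m u) ^ (3 / 2 : ℝ))⁻¹ •
      cross (deriv X u + s • deriv Y u) (y + s • (-Y u) - X u)) := by
  have hXc : Continuous X := hX.continuous
  have hX'c : Continuous (deriv X) := hX.continuous_deriv le_rfl
  have hYc : Continuous Y := hY.continuous
  have hY'c : Continuous (deriv Y) := hY.continuous_deriv le_rfl
  have hw : Continuous (fun u : ℝ => y + s • (-Y u) - X u) := by fun_prop
  have hpos : ∀ u, (0 : ℝ) < ‖y + s • (-Y u) - X u‖ ^ 2 + m u := fun u =>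
    add_pos_of_nonneg_of_pos (sq_nonneg _) (hm₀.trans_le (hm u))
  have hk : Continuous (fun u : ℝ => ((‖y + s • (-Y u) - X u‖ ^ 2 + m u) ^ (3 / 2 : ℝ))⁻¹) :=
    (((hw.norm.pow 2).add hmc).rpow_const fun u => Or.inl (hpos u).ne').inv₀
      fun u => (Real.rpow_pos_of_pos (hpos u) _).ne'
  have hcr : Continuous (fun u => cross (deriv X u + s • deriv Y u) (y + s • (-Y u) - X u)) :=
    (crossCLM.continuous.comp (by fun_prop : Continuous fun u => deriv X u + s • deriv Y u)).clm_apply hw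
  exact hk.smul hcr

/-- Continuity in `u` of the `s`-derivative of the variation integrand at parameter `s`. [folklore] -/
theorem continuous_variationDeriv {m : ℝ → ℝ} {m₀ : ℝ} (hm₀ : 0 < m₀) (hm : ∀ u, m₀ ≤ m u) (hmc : Continuous m)
    {X Y : ℝ → EuclideanSpace ℝ (Fin 3)} (hX : ContDiff ℝ 1 X) (hY : ContDiff ℝ 1 Y) (y : EuclideanSpace ℝ (Fin 3)) (s : ℝ) :
    Continuous (fun u : ℝ =>
      (-3 * inner ℝ (y + s • (-Y u) - X u) (-Y u) * ((‖y + s • (-Y u) - X u‖ ^ 2 + m u) ^ (5 / 2 : ℝ))⁻¹) •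
          cross (deriv X u + s • deriv Y u) (y + s • (-Y u) - X u) +
        ((‖y + s • (-Y u) - X u‖ ^ 2 + m u) ^ (3 / 2 : ℝ))⁻¹ •
          (cross (deriv X u + s • deriv Y u) (-Y u) + cross (deriv Y u) (y + s • (-Y u) - X u))) := by
  have hXc : Continuous X := hX.continuous
  have hX'c : Continuous (deriv X) := hX.continuous_deriv le_rfl
  have hYc : Continuous Y := hY.continuous
  have hY'c : Continuous (deriv Y) := hY.continuous_deriv le_rfl
  have hw : Continuous (fun u : ℝ => y + s • (-Y u) - X u) := by fun_prop
  have hp : Continuous (fun u : ℝ => deriv X u + s • deriv Y u) := by fun_prop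
  have hpos : ∀ u, (0 : ℝ) < ‖y + s • (-Y u) - X u‖ ^ 2 + m u := fun u =>
    add_pos_of_nonneg_of_pos (sq_nonneg _) (hm₀.trans_le (hm u))
  have hk : ∀ r : ℝ, Continuous (fun u : ℝ => ((‖y + s • (-Y u) - X u‖ ^ 2 + m u) ^ r)⁻¹) := fun r =>
    (((hw.norm.pow 2).add hmc).rpow_const fun u => Or.inl (hpos u).ne').inv₀
      fun u => (Real.rpow_pos_of_pos (hpos u) _).ne'
  have hcr1 : Continuous (fun u => cross (deriv X u + s • deriv Y u) (y + s • (-Y u) - X u)) :=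
    (crossCLM.continuous.comp hp).clm_apply hw
  have hcr2 : Continuous (fun u => cross (deriv X u + s • deriv Y u) (-Y u)) :=
    (crossCLM.continuous.comp hp).clm_apply hYc.neg
  have hcr3 : Continuous (fun u => cross (deriv Y u) (y + s • (-Y u) - X u)) :=
    (crossCLM.continuous.comp hY'c).clm_apply hw
  exact (((continuous_const.mul (hw.inner hYc.neg)).mul (hk _)).smul hcr1).add ((hk _).smul (hcr2.add hcr3))

/-- **THE VARIATION DERIVATIVE of the matched-core Biot–Savart field** (differentiation under the integral sign at `s = 0`,
line form `y + s•(−Y u) − X u`): for a `C¹` proper filament `X` (`‖X′‖ ≤ 1`, `c|u| − C ≤ ‖X u‖`), a `C¹` displacement `Y` with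
`‖Y u‖, ‖Y′ u‖ ≤ B`, and a continuous core profile `m ≥ m₀ > 0`, the derivative integrand is integrable and
`s ↦ ∫ K₃ • (X′ + sY′) × (y − X − sY)` has the stated derivative at `0`. [folklore] -/
theorem matchedBiotSavart_hasDerivAt_variation {m : ℝ → ℝ} {m₀ c C B : ℝ} {X Y : ℝ → EuclideanSpace ℝ (Fin 3)}
    (hm₀ : 0 < m₀) (hm : ∀ u, m₀ ≤ m u) (hmc : Continuous m) (hc : 0 < c) (hX : ContDiff ℝ 1 X)
    (hX1 : ∀ u, ‖deriv X u‖ ≤ 1) (hXg : ∀ u, c * |u| - C ≤ ‖X u‖) (hY : ContDiff ℝ 1 Y) (hB : 0 ≤ B)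
    (hYb : ∀ u, ‖Y u‖ ≤ B) (hY'b : ∀ u, ‖deriv Y u‖ ≤ B) (y : EuclideanSpace ℝ (Fin 3)) :
    Integrable (fun u : ℝ =>
        (-3 * inner ℝ (y - X u) (-Y u) * ((‖y - X u‖ ^ 2 + m u) ^ (5 / 2 : ℝ))⁻¹) • cross (deriv X u) (y - X u) +
          ((‖y - X u‖ ^ 2 + m u) ^ (3 / 2 : ℝ))⁻¹ • (cross (deriv X u) (-Y u) + cross (deriv Y u) (y - X u))) ∧
    HasDerivAt (fun s : ℝ => ∫ u : ℝ, ((‖y + s • (-Y u) - X u‖ ^ 2 + m u) ^ (3 / 2 : ℝ))⁻¹ •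
        cross (deriv X u + s • deriv Y u) (y + s • (-Y u) - X u))
      (∫ u : ℝ, ((-3 * inner ℝ (y - X u) (-Y u) * ((‖y - X u‖ ^ 2 + m u) ^ (5 / 2 : ℝ))⁻¹) •
          cross (deriv X u) (y - X u) +
        ((‖y - X u‖ ^ 2 + m u) ^ (3 / 2 : ℝ))⁻¹ • (cross (deriv X u) (-Y u) + cross (deriv Y u) (y - X u)))) 0 := by
  set M : ℝ := (4 * m₀ + c ^ 2 + 4 * (|C| + ‖y‖ + B + 1) ^ 2) / (c ^ 2 * m₀) with hM_def
  set Cst : ℝ := B + 4 * B * (1 + B) * (Real.sqrt m₀)⁻¹ with hCst_def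
  have hq : ∀ u, 0 < m u := fun u => hm₀.trans_le (hm u)
  -- the parametric family and its derivative
  set F : ℝ → ℝ → EuclideanSpace ℝ (Fin 3) := fun s u =>
    ((‖y + s • (-Y u) - X u‖ ^ 2 + m u) ^ (3 / 2 : ℝ))⁻¹ • cross (deriv X u + s • deriv Y u) (y + s • (-Y u) - X u)
    with hF_def
  set F' : ℝ → ℝ → EuclideanSpace ℝ (Fin 3) := fun s u =>
    (-3 * inner ℝ (y + s • (-Y u) - X u) (-Y u) * ((‖y + s • (-Y u) - X u‖ ^ 2 + m u) ^ (5 / 2 : ℝ))⁻¹) •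
        cross (deriv X u + s • deriv Y u) (y + s • (-Y u) - X u) +
      ((‖y + s • (-Y u) - X u‖ ^ 2 + m u) ^ (3 / 2 : ℝ))⁻¹ •
        (cross (deriv X u + s • deriv Y u) (-Y u) + cross (deriv Y u) (y + s • (-Y u) - X u)) with hF'_def
  have hF0 : F' 0 = fun u =>
      (-3 * inner ℝ (y - X u) (-Y u) * ((‖y - X u‖ ^ 2 + m u) ^ (5 / 2 : ℝ))⁻¹) • cross (deriv X u) (y - X u) +
        ((‖y - X u‖ ^ 2 + m u) ^ (3 / 2 : ℝ))⁻¹ • (cross (deriv X u) (-Y u) + cross (deriv Y u) (y - X u)) := by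
    funext u; simp [F']
  -- the key: Mathlib's dominated differentiation
  have key := hasDerivAt_integral_of_dominated_loc_of_deriv_le (μ := volume) (x₀ := (0:ℝ)) (F := F) (F' := F')
    (s := Metric.ball (0:ℝ) 1) (bound := fun u => Cst * (M * (1 + u ^ 2)⁻¹))
    (Metric.ball_mem_nhds (0:ℝ) one_pos) ?_ ?_ ?_ ?_ ?_ ?_
  · rw [hF0] at key
    refine ⟨key.1, ?_⟩
    have hfun : (fun s : ℝ => ∫ u : ℝ, F s u) = fun s : ℝ => ∫ u : ℝ, ((‖y + s • (-Y u) - X u‖ ^ 2 + m u) ^ (3 / 2 : ℝ))⁻¹ •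
        cross (deriv X u + s • deriv Y u) (y + s • (-Y u) - X u) := rfl
    rw [hfun] at key
    exact key.2
  · -- measurability of `F s`
    exact Eventually.of_forall fun s => (continuous_variationIntegrand hm₀ hm hmc hX hY y s).aestronglyMeasurable
  · -- integrability of `F 0` = the undisplaced integrand
    have h0 : F 0 = fun u => ((‖y - X u‖ ^ 2 + m u) ^ (3 / 2 : ℝ))⁻¹ • cross (deriv X u) (y - X u) := by
      funext u; simp [F]
    rw [h0]
    exact matchedBiotSavart_integrable hm₀ hm hmc hc hX hX1 hXg y
  · exact (continuous_variationDeriv hm₀ hm hmc hX hY y 0).aestronglyMeasurable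
  · -- the uniform bound on the ball `|s| < 1`
    refine Eventually.of_forall fun u s hs => ?_
    have hs' : |s| ≤ 1 := le_of_lt (by simpa [Real.dist_eq] using hs)
    have hnb : ‖-Y u‖ ≤ B := by rw [norm_neg]; exact hYb u
    have h1 := norm_variationDeriv_le (hq u) hB hs' (deriv X u) (deriv Y u) (y + s • (-Y u) - X u) (-Y u)
      (hX1 u) (hY'b u) hnb
    refine h1.trans ?_
    -- `(√(m u))⁻¹ ≤ (√m₀)⁻¹` and the domination `(‖w‖² + m u)⁻¹ ≤ M (1+u²)⁻¹`
    have hsq : (Real.sqrt (m u))⁻¹ ≤ (Real.sqrt m₀)⁻¹ :=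
      inv_anti₀ (Real.sqrt_pos.2 hm₀) (Real.sqrt_le_sqrt (hm u))
    have hz : ‖(y + s • (-Y u)) - y‖ ≤ B := by
      rw [add_sub_cancel_left, norm_smul, Real.norm_eq_abs]
      calc |s| * ‖-Y u‖ ≤ 1 * B := mul_le_mul hs' hnb (norm_nonneg _) zero_le_one
        _ = B := one_mul _
    have hdom := inv_le_of_norm_sub_le hm₀ hm hc hXg hB y hz u
    have hCst1 : B + 4 * B * (1 + B) * (Real.sqrt (m u))⁻¹ ≤ Cst := by
      rw [hCst_def]; gcongr
    have hpos : 0 ≤ (‖y + s • (-Y u) - X u‖ ^ 2 + m u)⁻¹ :=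
      inv_nonneg.2 (add_pos_of_nonneg_of_pos (sq_nonneg _) (hq u)).le
    have hCst0 : 0 ≤ Cst := by rw [hCst_def]; positivity
    calc (B + 4 * B * (1 + B) * (Real.sqrt (m u))⁻¹) * (‖y + s • (-Y u) - X u‖ ^ 2 + m u)⁻¹
        ≤ Cst * (‖y + s • (-Y u) - X u‖ ^ 2 + m u)⁻¹ := mul_le_mul_of_nonneg_right hCst1 hpos
      _ ≤ Cst * (M * (1 + u ^ 2)⁻¹) := mul_le_mul_of_nonneg_left hdom hCst0
  · exact (integrable_inv_one_add_sq.const_mul M).const_mul Cst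
  · exact Eventually.of_forall fun u s _ =>
      variationIntegrand_hasDerivAt (hq u) (deriv X u) (deriv Y u) y (-Y u) (X u) s

end Summit.NavierStokesRegularity.NavierStokesRegularity.Theorems.MatchedKernel
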